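import Summits.KontsevichZagierPeriods.Zeta5Search.QWedgeCFQAssembly

/-!
# CF-Q (4/5): polynomial interpolation in `n`

HONEST FRAMING: systematic search; no irrationality claim unless certified.

Cell `pub-zeta5`, TYPER g6.  Part of the Lean proof of **CF-Q** (`WedgeDictionary.QWedgeClosedForm`, the closed form of
Brown–Zudilin's leading coefficient `Q(a)` (arXiv:2210.03391, (17)) on the eight-parameter wedge as a factorial ratio
times a terminating very-well-poised `₉F₈(1)`), found and proved on paper by planner gen-1 g4
(`pub-zeta5-gen-1/PROOF-NOTES-g4.md` §9: trinomial revision → Burchnall–Chaundy/Dougall → Pfaff–Saalschütz ×4 → a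
Pochhammer identity), formalised here.  Files: `QWedgeCFQBasic` (toolkit, the `b`-coordinate double sum, Step 1),
`QWedgeCFQKernel` (Steps 2–3), `QWedgeCFQAssembly` (Step 4, the identity for `n ≥ 2S+2`), `QWedgeCFQInterpolation`
(polynomial interpolation in `n` down to the pair conditions), `QWedgeClosedFormProof` (the dictionary `a ↔ (n,b)` and
`QWedgeClosedForm_holds`).

This file: the hypergeometric chain of files 1–3 needs `n ≥ 2S+2` (non-vanishing Pochhammer denominators; at small
`n` the Saalschütz closed forms degenerate although the binomial sums do not).  Both sides of `cfq_large`, multiplied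
by `Z(n) = (n+1)·n!⁶/(∏_N (n−b_j−b_k)!·∏_j (n−b_j−β)!)` (`β = min_j b_j`), are values at `X = n` of fixed polynomials
`PLfull b`, `PRfull b ∈ ℚ[X]` for every `n` satisfying eleven pair conditions (`PairCond`); the two polynomials agree
at all large `n`, hence are equal (`PLfull_eq_PRfull`), which gives **`cfq_bform`**: the CF-Q identity in
`b`-coordinates for every admissible `n`.
-/

open Finset Polynomial

namespace Summit.KontsevichZagierPeriods.Zeta5Search.CFQ

open Summit.KontsevichZagierPeriods.Zeta5Search.Hypergeometric
open Literature.NumberTheory.Irrationality.BrownZudilin2022 (zchoose)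

/-! ## (B) Polynomial interpolation in `n`

Both sides of `cfq_large`, multiplied by `Z(n) = (n+1)·n!⁶ / (∏_N (n−b_j−b_k)! · ∏_j (n−b_j−β)!)` (`β = min_j b_j`),
are values at `X = n` of polynomials in `ℚ[X]` (for all `n` satisfying the pair conditions); two polynomials
that agree at all `n ≥ 2S+2` are equal, so the identity descends to every admissible `n`. -/

/-- `C(X + s, k)` as a polynomial in `X` (`0` for `k < 0`): `(X+s)(X+s−1)⋯(X+s−k+1)/k!`. -/
noncomputable def pbinom (s k : ℤ) : ℚ[X] :=
  if 0 ≤ k then C ((k.toNat.factorial : ℚ)⁻¹) * (descPochhammer ℚ k.toNat).comp (X + C (s : ℚ)) else 0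

/-- Evaluation of `pbinom` at a natural number `x` with `x + s = M ≥ 0`: the integer binomial `zchoose M k`. -/
theorem pbinom_eval {s k M : ℤ} {x : ℕ} (hx : (x : ℤ) + s = M) (hM : 0 ≤ M) :
    (pbinom s k).eval (x : ℚ) = ((zchoose M k : ℤ) : ℚ) := by
  obtain ⟨N, rfl⟩ := Int.eq_ofNat_of_zero_le hM
  unfold pbinom
  by_cases hk : 0 ≤ k
  · obtain ⟨K, rfl⟩ := Int.eq_ofNat_of_zero_le hk
    have hxs : (x : ℚ) + (s : ℚ) = (N : ℚ) := by exact_mod_cast hx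
    rw [if_pos hk, Int.toNat_natCast, eval_mul, eval_C, eval_comp, eval_add, eval_X, eval_C, hxs,
      descPochhammer_eval_eq_descFactorial]
    by_cases hKN : K ≤ N
    · rw [zchoose_cast (nN := N) (nK := K) rfl rfl hKN]
      have h := Nat.factorial_mul_descFactorial hKN
      have h' : (((N - K).factorial : ℕ) : ℚ) * (N.descFactorial K : ℚ) = (N.factorial : ℚ) := by
        exact_mod_cast h
      have h1 : (((N - K).factorial : ℕ) : ℚ) ≠ 0 := by positivity
      have h2 : ((K.factorial : ℕ) : ℚ) ≠ 0 := by positivity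
      field_simp
      linear_combination h'
    · push Not at hKN
      rw [zchoose_lt (by exact_mod_cast hKN), Nat.descFactorial_eq_zero_iff_lt.2 hKN]; simp
  · rw [if_neg hk, zchoose_neg (by omega)]; simp

/-- The (17)-summand as a polynomial in `n` (same factors as `termZ`). -/
noncomputable def termP (b : ℕ → ℕ) (u v : ℕ) : ℚ[X] :=
  pbinom (-(u : ℤ) - b 6) ((b 4 : ℤ) - u) * pbinom (-(v : ℤ) - b 6) ((b 1 : ℤ) - v) *
    pbinom (-(u : ℤ) - v) (b 6) * C (((zchoose (b 3) u : ℤ) : ℚ)) * pbinom (-(b 3 : ℤ) - b 4) ((b 5 : ℤ) - u) *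
    pbinom (-(b 1 : ℤ) - b 2) ((b 7 : ℤ) - v) * C (((zchoose (b 2) v : ℤ) : ℚ))

/-- `L(b;X) = Σ_{u ≤ b₃} Σ_{v ≤ b₇} termP` — the double sum as a polynomial in `n`. -/
noncomputable def LsumP (b : ℕ → ℕ) : ℚ[X] :=
  ∑ u ∈ range (b 3 + 1), ∑ v ∈ range (b 7 + 1), termP b u v

/-- `L(b;X)` evaluates to `L(b;n)` at every `n` with `b₃+b₆, b₆+b₇, b₃+b₇, b₃+b₄, b₁+b₂ ≤ n`. -/
theorem LsumP_eval {n : ℕ} {b : ℕ → ℕ} (h36 : b 3 + b 6 ≤ n) (h67 : b 6 + b 7 ≤ n) (h37 : b 3 + b 7 ≤ n)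
    (h34 : b 3 + b 4 ≤ n) (h12 : b 1 + b 2 ≤ n) : (LsumP b).eval (n : ℚ) = (LsumZ n b : ℚ) := by
  unfold LsumP LsumZ
  rw [eval_finsetSum]; push_cast
  refine sum_congr rfl fun u hu => ?_
  rw [eval_finsetSum]
  refine sum_congr rfl fun v hv => ?_
  rw [mem_range] at hu hv
  unfold termP termZ
  simp only [eval_mul, eval_C]
  rw [pbinom_eval (M := (n : ℤ) - u - b 6) (by ring) (by omega),
    pbinom_eval (M := (n : ℤ) - v - b 6) (by ring) (by omega),
    pbinom_eval (M := (n : ℤ) - u - v) (by ring) (by omega),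
    pbinom_eval (M := (n : ℤ) - b 3 - b 4) (by ring) (by omega),
    pbinom_eval (M := (n : ℤ) - b 1 - b 2) (by ring) (by omega)]
  push_cast
  ring

/-- `β = min_j b_j`. -/
def bmin (b : ℕ → ℕ) : ℕ := min (min (min (min (min (min (b 1) (b 2)) (b 3)) (b 4)) (b 5)) (b 6)) (b 7)

/-- `β ≤ b_j`. -/
theorem bmin_le (b : ℕ → ℕ) : ∀ j ∈ range 7, bmin b ≤ b (j + 1) := by
  intro j hj
  rw [mem_range] at hj
  unfold bmin
  interval_cases j <;> simp only [Nat.reduceAdd, zero_add] <;> omega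

/-- Beyond `β` some `b_j` is exceeded. -/
theorem exists_lt_of_bmin_lt {b : ℕ → ℕ} {m : ℕ} (h : bmin b < m) : ∃ j ∈ range 7, b (j + 1) < m := by
  by_contra hc
  push Not at hc
  have h1 := hc 0 (by simp); have h2 := hc 1 (by simp); have h3 := hc 2 (by simp); have h4 := hc 3 (by simp)
  have h5 := hc 4 (by simp); have h6 := hc 5 (by simp); have h7 := hc 6 (by simp)
  simp only [Nat.reduceAdd, zero_add] at h1 h2 h3 h4 h5 h6 h7
  unfold bmin at h
  omega

/-- The `m`-th term of `Ω(b;X)·(X+1)·∏_j (X−b_j)_{β}↓` as a polynomial in `X` (`m ≤ β`):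
`(X+1−2m)·(−1)^m (X+1)_m↓/m! · ∏_j (−b_j)_m (−1)^m (X−b_j−m)_{β−m}↓`. -/
noncomputable def OmegaTermP (b : ℕ → ℕ) (m : ℕ) : ℚ[X] :=
  (X + C (1 - 2 * (m : ℚ))) * C ((-1) ^ m / (m.factorial : ℚ)) * (descPochhammer ℚ m).comp (X + 1) *
    ∏ j ∈ range 7, C (ph (-(b (j + 1) : ℚ)) m * (-1) ^ m) *
      (descPochhammer ℚ (bmin b - m)).comp (X - C ((b (j + 1) + m : ℕ) : ℚ))

/-- Evaluation of `OmegaTermP` (`m ≤ β`, `b_j + β ≤ n`):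
`Ω_m(n) · (n+1) · ∏_j (n−b_j)!/(n−b_j−β)!`. -/
theorem OmegaTermP_eval {n : ℕ} {b : ℕ → ℕ} {m : ℕ} (hm : m ≤ bmin b) (hn : ∀ j ∈ range 7, b (j + 1) + bmin b ≤ n) :
    (OmegaTermP b m).eval (n : ℚ) =
      OmegaTerm n b m * ((n : ℚ) + 1) * ∏ j ∈ range 7, fq (n - b (j + 1)) / fq (n - b (j + 1) - bmin b) := by
  unfold OmegaTermP OmegaTerm
  rw [eval_mul, eval_mul, eval_mul, eval_prod, eval_add, eval_X, eval_C, eval_C, eval_comp, eval_add,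
    eval_X, eval_one]
  -- scalar part and `j`-part separately
  have hβ := bmin_le b
  have hscal : ((n : ℚ) + (1 - 2 * (m : ℚ))) * ((-1) ^ m / (m.factorial : ℚ)) * (descPochhammer ℚ m).eval ((n : ℚ) + 1) =
      (1 - 2 * (m : ℚ) / ((n : ℚ) + 1)) * (ph (-(n : ℚ) - 1) m / (m.factorial : ℚ)) * ((n : ℚ) + 1) := by
    rw [show (n : ℚ) + 1 = ((n + 1 : ℕ) : ℚ) by push_cast; ring, descPochhammer_eval_eq_descFactorial,
      ph_negNat (x := -(n : ℚ) - 1) (n + 1) m (n + 1 - m) (by push_cast; ring)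
        (by have := hn 0 (by simp); have := hβ 0 (by simp); omega)]
    have h := Nat.factorial_mul_descFactorial (show m ≤ n + 1 by have := hn 0 (by simp); have := hβ 0 (by simp); omega)
    have h' : (((n + 1 - m).factorial : ℕ) : ℚ) * ((n + 1).descFactorial m : ℚ) = ((n + 1).factorial : ℚ) := by
      exact_mod_cast h
    unfold fq
    have h1 : (((n + 1 - m).factorial : ℕ) : ℚ) ≠ 0 := by positivity
    have h2 : ((m.factorial : ℕ) : ℚ) ≠ 0 := by positivity
    have h3 : (((n + 1 : ℕ) : ℚ)) ≠ 0 := by positivity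
    rw [show ((n + 1).descFactorial m : ℚ) = ((n + 1).factorial : ℚ) / (((n + 1 - m).factorial : ℕ) : ℚ) by
      rw [eq_div_iff h1]; linear_combination h']
    field_simp
    push_cast
    ring
  have hj : ∀ j ∈ range 7, (C (ph (-(b (j + 1) : ℚ)) m * (-1) ^ m) *
      (descPochhammer ℚ (bmin b - m)).comp (X - C ((b (j + 1) + m : ℕ) : ℚ))).eval (n : ℚ) =
      ph (-(b (j + 1) : ℚ)) m / ph ((b (j + 1) : ℚ) - n) m * (fq (n - b (j + 1)) / fq (n - b (j + 1) - bmin b)) := by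
    intro j hjr
    have hjn := hn j hjr
    have hjβ := hβ j hjr
    rw [eval_mul, eval_C, eval_comp, eval_sub, eval_X, eval_C,
      show (n : ℚ) - ((b (j + 1) + m : ℕ) : ℚ) = ((n - b (j + 1) - m : ℕ) : ℚ) by
        rw [natCast_sub_sub (by omega)]; push_cast; ring,
      descPochhammer_eval_eq_descFactorial,
      ph_negNat (x := ((b (j + 1) : ℕ) : ℚ) - n) (n - b (j + 1)) m (n - b (j + 1) - m)
        (by rw [Nat.cast_sub (by omega)]; ring) (by omega)]
    have h := Nat.factorial_mul_descFactorial (show bmin b - m ≤ n - b (j + 1) - m by omega)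
    rw [show n - b (j + 1) - m - (bmin b - m) = n - b (j + 1) - bmin b by omega] at h
    have h' : (((n - b (j + 1) - bmin b).factorial : ℕ) : ℚ) * ((n - b (j + 1) - m).descFactorial (bmin b - m) : ℚ) =
        ((n - b (j + 1) - m).factorial : ℚ) := by exact_mod_cast h
    unfold fq
    have h1 : (((n - b (j + 1) - bmin b).factorial : ℕ) : ℚ) ≠ 0 := by positivity
    have h2 : (((n - b (j + 1) - m).factorial : ℕ) : ℚ) ≠ 0 := by positivity
    have h3 : (((n - b (j + 1)).factorial : ℕ) : ℚ) ≠ 0 := by positivity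
    rw [show ((n - b (j + 1) - m).descFactorial (bmin b - m) : ℚ) =
        ((n - b (j + 1) - m).factorial : ℚ) / (((n - b (j + 1) - bmin b).factorial : ℕ) : ℚ) by
      rw [eq_div_iff h1]; linear_combination h']
    obtain hs | hs := neg_one_pow_eq_or ℚ m <;> simp only [hs] <;> field_simp
  rw [hscal, prod_congr rfl hj, prod_mul_distrib]
  ring

/-- The `L`-side polynomial: `L(b;X) · ∏_J b_j! · ∏_j (X)_{b_j+β}↓ · (X+1)`. -/
noncomputable def PLfull (b : ℕ → ℕ) : ℚ[X] :=
  LsumP b * C (fq (b 1) * fq (b 4) * fq (b 5) * fq (b 6) * fq (b 7)) *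
    (∏ j ∈ range 7, descPochhammer ℚ (b (j + 1) + bmin b)) * (X + 1)

/-- The `Ω`-side polynomial: `(Σ_{m ≤ β} OmegaTermP m) · ∏_N (X)_{b_j+b_k}↓`. -/
noncomputable def PRfull (b : ℕ → ℕ) : ℚ[X] :=
  (∑ m ∈ range (bmin b + 1), OmegaTermP b m) *
    (descPochhammer ℚ (b 1 + b 6) * descPochhammer ℚ (b 1 + b 7) * descPochhammer ℚ (b 2 + b 7) *
      descPochhammer ℚ (b 3 + b 5) * descPochhammer ℚ (b 4 + b 5) * descPochhammer ℚ (b 4 + b 6))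

/-- The normalising factor `Z(n) = (n+1)·n!⁶ / (∏_N (n−b_j−b_k)! · ∏_j (n−b_j−β)!)`. -/
noncomputable def Zfac (n : ℕ) (b : ℕ → ℕ) : ℚ :=
  ((n : ℚ) + 1) * fq n ^ 6 /
    ((fq (n - b 1 - b 6) * fq (n - b 1 - b 7) * fq (n - b 2 - b 7) * fq (n - b 3 - b 5) *
        fq (n - b 4 - b 5) * fq (n - b 4 - b 6)) * ∏ j ∈ range 7, fq (n - b (j + 1) - bmin b))

/-- `Z(n) ≠ 0`. -/
theorem Zfac_ne_zero (n : ℕ) (b : ℕ → ℕ) : Zfac n b ≠ 0 := by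
  unfold Zfac
  have : (n : ℚ) + 1 ≠ 0 := by positivity
  have hF := fq_ne_zero
  refine div_ne_zero (mul_ne_zero this (pow_ne_zero _ (hF n))) (mul_ne_zero ?_ ?_)
  · exact mul_ne_zero (mul_ne_zero (mul_ne_zero (mul_ne_zero (mul_ne_zero (hF _) (hF _)) (hF _)) (hF _)) (hF _)) (hF _)
  · exact prod_ne_zero_iff.2 fun j _ => hF _

/-- The eleven pair conditions used by the interpolation step. -/
def PairCond (n : ℕ) (b : ℕ → ℕ) : Prop :=
  b 1 + b 2 ≤ n ∧ b 3 + b 4 ≤ n ∧ b 3 + b 6 ≤ n ∧ b 3 + b 7 ≤ n ∧ b 6 + b 7 ≤ n ∧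
    b 1 + b 6 ≤ n ∧ b 1 + b 7 ≤ n ∧ b 2 + b 7 ≤ n ∧ b 3 + b 5 ≤ n ∧ b 4 + b 5 ≤ n ∧ b 4 + b 6 ≤ n

/-- `(X)_k↓` at `n ≥ k`: `n!/(n−k)!`. -/
theorem descPochhammer_eval_fq {n k : ℕ} (h : k ≤ n) :
    (descPochhammer ℚ k).eval (n : ℚ) = fq n / fq (n - k) := by
  rw [descPochhammer_eval_eq_descFactorial]
  have h1 := Nat.factorial_mul_descFactorial h
  have h' : (((n - k).factorial : ℕ) : ℚ) * (n.descFactorial k : ℚ) = (n.factorial : ℚ) := by exact_mod_cast h1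
  unfold fq
  rw [eq_div_iff (by positivity)]
  linear_combination h'

/-- Evaluation of the `L`-side polynomial. -/
theorem PLfull_eval {n : ℕ} {b : ℕ → ℕ} (hp : PairCond n b) :
    (PLfull b).eval (n : ℚ) =
      (LsumZ n b : ℚ) * (fq n * (fq (b 1) * fq (b 4) * fq (b 5) * fq (b 6) * fq (b 7)) *
          (fq (n - b 1 - b 6) * fq (n - b 1 - b 7) * fq (n - b 2 - b 7) * fq (n - b 3 - b 5) *
            fq (n - b 4 - b 5) * fq (n - b 4 - b 6))) * Zfac n b := by
  obtain ⟨h12, h34, h36, h37, h67, h16, h17, h27, h35, h45, h46⟩ := hp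
  have hβ := bmin_le b
  have hb1 := hβ 0 (by simp); have hb2 := hβ 1 (by simp); have hb4 := hβ 3 (by simp); have hb5 := hβ 4 (by simp)
  simp only [zero_add, Nat.reduceAdd] at hb1 hb2 hb4 hb5
  have hjn : ∀ j ∈ range 7, b (j + 1) + bmin b ≤ n := by
    intro j hj; rw [mem_range] at hj
    interval_cases j <;> simp only [zero_add, Nat.reduceAdd] <;> omega
  unfold PLfull Zfac
  rw [eval_mul, eval_mul, eval_mul, eval_C, eval_prod, eval_add, eval_X, eval_one, LsumP_eval h36 h67 h37 h34 h12,
    prod_congr rfl fun j hj => descPochhammer_eval_fq (hjn j hj)]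
  simp only [prod_range_succ, prod_range_zero, one_mul, zero_add, Nat.reduceAdd]
  rw [show n - (b 1 + bmin b) = n - b 1 - bmin b by omega, show n - (b 2 + bmin b) = n - b 2 - bmin b by omega,
    show n - (b 3 + bmin b) = n - b 3 - bmin b by omega, show n - (b 4 + bmin b) = n - b 4 - bmin b by omega,
    show n - (b 5 + bmin b) = n - b 5 - bmin b by omega, show n - (b 6 + bmin b) = n - b 6 - bmin b by omega,
    show n - (b 7 + bmin b) = n - b 7 - bmin b by omega]
  have hF := fq_ne_zero
  have := hF n; have := hF (n - b 1 - b 6); have := hF (n - b 1 - b 7); have := hF (n - b 2 - b 7)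
  have := hF (n - b 3 - b 5); have := hF (n - b 4 - b 5); have := hF (n - b 4 - b 6)
  have := hF (n - b 1 - bmin b); have := hF (n - b 2 - bmin b); have := hF (n - b 3 - bmin b)
  have := hF (n - b 4 - bmin b); have := hF (n - b 5 - bmin b); have := hF (n - b 6 - bmin b); have := hF (n - b 7 - bmin b)
  field_simp

/-- Evaluation of the `Ω`-side polynomial. -/
theorem PRfull_eval {n : ℕ} {b : ℕ → ℕ} (hp : PairCond n b) :
    (PRfull b).eval (n : ℚ) =
      fq (n - b 1) * fq (n - b 2) * fq (n - b 3) * fq (n - b 4) * fq (n - b 5) * fq (n - b 6) * fq (n - b 7) *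
        OmegaQ n b * Zfac n b := by
  obtain ⟨h12, h34, h36, h37, h67, h16, h17, h27, h35, h45, h46⟩ := hp
  have hβ := bmin_le b
  have hb1 := hβ 0 (by simp); have hb2 := hβ 1 (by simp); have hb4 := hβ 3 (by simp); have hb5 := hβ 4 (by simp)
  have hb7 := hβ 6 (by simp)
  simp only [zero_add, Nat.reduceAdd] at hb1 hb2 hb4 hb5 hb7
  have hjn : ∀ j ∈ range 7, b (j + 1) + bmin b ≤ n := by
    intro j hj; rw [mem_range] at hj
    interval_cases j <;> simp only [zero_add, Nat.reduceAdd] <;> omega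
  -- `Ω(b;n) = Σ_{m ≤ β} Ω_m`
  have hΩ : OmegaQ n b = ∑ m ∈ range (bmin b + 1), OmegaTerm n b m := by
    unfold OmegaQ
    symm
    refine sum_subset (range_subset_range.2 (by omega)) fun m hm hm' => ?_
    rw [mem_range] at hm hm'
    obtain ⟨j, hj, hlt⟩ := exists_lt_of_bmin_lt (b := b) (m := m) (by omega)
    exact OmegaTerm_eq_zero (mem_range.1 hj) hlt
  unfold PRfull Zfac
  rw [eval_mul, eval_finsetSum, sum_congr rfl fun m hm => OmegaTermP_eval (by rw [mem_range] at hm; omega) hjn,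
    ← sum_mul, ← sum_mul, ← hΩ]
  simp only [eval_mul, descPochhammer_eval_fq h16, descPochhammer_eval_fq h17, descPochhammer_eval_fq h27,
    descPochhammer_eval_fq h35, descPochhammer_eval_fq h45, descPochhammer_eval_fq h46]
  simp only [prod_range_succ, prod_range_zero, one_mul, zero_add, Nat.reduceAdd]
  rw [show n - (b 1 + b 6) = n - b 1 - b 6 by omega, show n - (b 1 + b 7) = n - b 1 - b 7 by omega,
    show n - (b 2 + b 7) = n - b 2 - b 7 by omega, show n - (b 3 + b 5) = n - b 3 - b 5 by omega,
    show n - (b 4 + b 5) = n - b 4 - b 5 by omega, show n - (b 4 + b 6) = n - b 4 - b 6 by omega]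
  have hF := fq_ne_zero
  have := hF n; have := hF (n - b 1 - b 6); have := hF (n - b 1 - b 7); have := hF (n - b 2 - b 7)
  have := hF (n - b 3 - b 5); have := hF (n - b 4 - b 5); have := hF (n - b 4 - b 6)
  have := hF (n - b 1 - bmin b); have := hF (n - b 2 - bmin b); have := hF (n - b 3 - bmin b)
  have := hF (n - b 4 - bmin b); have := hF (n - b 5 - bmin b); have := hF (n - b 6 - bmin b); have := hF (n - b 7 - bmin b)
  have := hF (n - b 1); have := hF (n - b 2); have := hF (n - b 3); have := hF (n - b 4); have := hF (n - b 5)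
  have := hF (n - b 6); have := hF (n - b 7)
  have : (n : ℚ) + 1 ≠ 0 := by positivity
  field_simp

/-- `PairCond` holds for all large `n`. -/
theorem pairCond_of_large {n : ℕ} {b : ℕ → ℕ} (hN : 2 * S7 b + 2 ≤ n) : PairCond n b := by
  unfold S7 at hN; unfold PairCond; omega

/-- **The two polynomials coincide** (they agree at every `n ≥ 2S+2`). -/
theorem PLfull_eq_PRfull (b : ℕ → ℕ) : PLfull b = PRfull b := by
  apply Polynomial.eq_of_infinite_eval_eq
  have hsub : (fun k : ℕ => ((k + (2 * S7 b + 2) : ℕ) : ℚ)) '' Set.univ ⊆ {x : ℚ | (PLfull b).eval x = (PRfull b).eval x} := by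
    rintro x ⟨k, -, rfl⟩
    have hN : 2 * S7 b + 2 ≤ k + (2 * S7 b + 2) := by omega
    show (PLfull b).eval (((k + (2 * S7 b + 2) : ℕ)) : ℚ) = (PRfull b).eval (((k + (2 * S7 b + 2) : ℕ)) : ℚ)
    rw [PLfull_eval (pairCond_of_large hN), PRfull_eval (pairCond_of_large hN), cfq_large hN]
  refine Set.Infinite.mono hsub (Set.infinite_univ.image fun x _ y _ hxy => ?_)
  have : (x + (2 * S7 b + 2) : ℕ) = y + (2 * S7 b + 2) := by exact_mod_cast hxy
  omega

/-- **CF-Q in `b`-coordinates, for every admissible `n`** (the eleven pair conditions `PairCond`):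
`L(b;n) · n! · b₁!b₄!b₅!b₆!b₇! · ∏_N (n−b_j−b_k)! = ∏_j (n−b_j)! · Ω(b;n)`. -/
theorem cfq_bform {n : ℕ} {b : ℕ → ℕ} (hp : PairCond n b) :
    (LsumZ n b : ℚ) * (fq n * (fq (b 1) * fq (b 4) * fq (b 5) * fq (b 6) * fq (b 7)) *
          (fq (n - b 1 - b 6) * fq (n - b 1 - b 7) * fq (n - b 2 - b 7) * fq (n - b 3 - b 5) *
            fq (n - b 4 - b 5) * fq (n - b 4 - b 6))) =
      fq (n - b 1) * fq (n - b 2) * fq (n - b 3) * fq (n - b 4) * fq (n - b 5) * fq (n - b 6) * fq (n - b 7) *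
        OmegaQ n b := by
  have h : (PLfull b).eval (n : ℚ) = (PRfull b).eval (n : ℚ) := by rw [PLfull_eq_PRfull]
  rw [PLfull_eval hp, PRfull_eval hp] at h
  exact mul_right_cancel₀ (Zfac_ne_zero n b) h


end Summit.KontsevichZagierPeriods.Zeta5Search.CFQ
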